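import Literature.AlgebraicGeometry.Modules.PushforwardHasRankOfFibreVanishing
import Literature.AlgebraicGeometry.Morphisms.SectionsBaseChangeOfFibreVanishingPoints
import Literature.AlgebraicGeometry.Modules.PullbackSectionsTransport
import Literature.AlgebraicGeometry.Modules.FittingIdealSheafRank
import Literature.AlgebraicGeometry.Modules.FlatteningStratificationDecomposition
import Literature.AlgebraicGeometry.Modules.CohomologyFlatBaseChange
import Literature.AlgebraicGeometry.Modules.DetClassOfIso
import Literature.AlgebraicGeometry.Morphisms.SectionsRankOfFibreVanishing
import Literature.AlgebraicGeometry.Motives.ProjectiveFibreHilbertPolynomialTwistsSpan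
import Literature.AlgebraicGeometry.Modules.SerreTwistModProjMap
import Literature.AlgebraicGeometry.Modules.ProjectiveFamilyTwistPushforward
import Literature.AlgebraicGeometry.Morphisms.AffineSpaceCompactification
import Literature.Algebra.Homology.LaurentCechHilbertPolynomial
import HarnessLib

/-!
# The twists `k^* 𝒪_Z(d)` on the fibres of a flat closed family `Z ⊆ 𝐏(ι; T)` with locally free direct images
# (Mumford, *Lectures on curves on an algebraic surface*, Lecture 8, 3° (ii) on one flat stratum; Hartshorne III Thm. 9.9, Cor. 12.9)

Layer `Literature/AlgebraicGeometry/Motives` (§2 in `Literature.AlgebraicGeometry.Modules`, §3–§4 in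
`Literature.AlgebraicGeometry.Motives`).  THEOREMS ONLY: no definition, no instance (one ★-standard LOCAL instance attribute,
`MvPolynomial.gradedAlgebra`, needed to write `Proj.map : 𝐏ⁿ_K ⟶ 𝐏ⁿ_ℤ`), no notation, no named fact, no `sorry`.  Universe `0`
(that of the fibre dictionary ★ `Motives/ProjectiveFibreHilbertPolynomialTwists`).

Mumford, Lecture 8, 3° (p. 58), building the Hilbert scheme stratum by stratum: on a piece `T` of the flattening stratification
the family `Z ⊆ ℙⁿ × T` is FLAT with `ℰ_e = (p_Z)_* 𝒪_Z(e)` LOCALLY FREE OF RANK `P(e)` for `e ≥ e₀`; then (ii) «the Hilbert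
polynomial of `𝒪_{Z_t}` is `P` for every `t ∈ T`», and for `d` beyond the uniform regularity bound `B(P)` of Lecture 14 the
fibrewise statements (i) «`ℰ_d ⊗ κ(t) ≅ H⁰(Z_t, 𝒪_{Z_t}(d))`, `H¹(Z_t, 𝒪_{Z_t}(d)) = 0`, `𝒪_{Z_t}(d)` generated by the degree-`d`
monomials» hold at every point — these are exactly the three field-point letters `hvan` ∕ `hrank` ∕ `hspan` under which ★
`Motives/FlatFamilyGrassmannianPoint.existsUnique_hom_grassmannian_of_forall_fieldPoint` produces the `T`-point of the
Grassmannian (the cell's F-5 slot ③; this file is ③a, the consumer ③b is edition 2 of ★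
`Motives/FlatFamilyHilbertPolynomialGrassmannianPoint`, which presents every fibre and descends from infinite to arbitrary
residue fields).

* §2 **`Modules.finrank_secMod_fibre_eq_of_hasRank_pushforward`** (generic; Hartshorne III Cor. 12.9 ∕ Mumford §5 Cor. 2–3 read
  backwards, POINTWISE): `p : X → S` proper flat, `S` locally Noetherian, `G` finite locally free with `p_* G` locally free of
  rank `r`; at a field point `x : Spec K → S` whose fibre `X₀` has `Ext¹(𝒪_{X₀}, G|_{X₀}) = 0`, `dim Γ(X₀, G|_{X₀}) = r`.
  (Affine chart `V ∋ x`, the (S3) transport `Γ(p⁻¹V, G) ≅ Γ(p_* G, V)` of ★ `Modules/PushforwardHasRankOfFibreVanishing`, the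
  local step ★ `Morphisms.finrank_tensor_secMod_top_atPrime` at the prime CONTRACTED from `Γ(Spec Γ(S, V), 𝒪)` — so that ★
  `isLocalization_atPrime_Γ_Spec` applies literally —, Mathlib `Module.rankAtStalk_eq_finrank_tensorProduct`, and invariance
  of `Ext¹ = 0` and `h⁰` under the residue field extension `κ(y) → K`, ★ `Modules/CohomologyFlatBaseChange` §4.)
* §3 **`hilbertPolynomial_fibre_eq_of_hasRank_twists`** (Mumford 3° (ii) ∕ Hartshorne III 9.9 on one fibre): for a closed
  `i : Z ⊆ 𝐏(ι; T)` flat over `T` with `HasRank ((p_Z)_* 𝒪_Z(e)) (P e)` for `e ≥ e₀`, a fibre `X₀` at a field point with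
  INFINITE residue field `K`, PRESENTED as `ιK : X₀ ⊆ 𝐏ⁿ_K` (`hf₀`, and the square `w` over `Proj (ℤ[x] → K[x])` of ★
  `SerreTwist.exists_pullback_twistMod_iso_of_sq`), has Hilbert polynomial `QZ = P` (`QZ` = alternating Čech dimensions of
  `X₀ ⊆ 𝐏ⁿ_K`, ★ `LaurentCech.exists_hilbertPolynomial`): for large `e` both equal `h⁰(X₀, 𝒪_{X₀}(e))` (★ L-a (a)(b) + §2).
* §4 the three letters at a presented field point with infinite residue field, for `d ≥ B(P) − 1` and `k = P(d)`:
  **(E1) `subsingleton_ext_one_pullback_twistMod_of_hasRank_twists`** (`Ext¹(𝒪_{X₀}, k^* 𝒪_Z(d)) = 0`),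
  **(E2) `finrank_secMod_pullback_twistMod_of_hasRank_twists`** (`dim_{Γ(Spec K, 𝒪)} Γ(X₀, k^* 𝒪_Z(d)) = k`),
  **(E3) `secMod_mk_mem_span_monomialSection_of_hasRank_twists`** (the restricted monomial sections `η_k(μ_w|_Z)` span) — ★ L-a
  `subsingleton_ext_one_twistMod_of_hilbertPolynomial` ∕ `finrank_secMod_twistMod_eq_eval_of_hilbertPolynomial` ∕
  `span_monomialSections_eq_top_of_hilbertPolynomial` for `𝒪_{X₀}(d)` with `QZ = P` (§3), moved along `k^* 𝒪_Z(d) ≅ 𝒪_{X₀}(d)`,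
  `η_k(μ_w|_Z) ↦ μ_w|_{X₀}`.
The binders of §3–§4 are the machine-checked socket of ③b (cell record `Slot3b.SOCKETS` 9e101c4e ∕ d919e393).

Cell `hodgecm-mathlib` (D-0151), F-5 (5b) slot ③a (B-p01 (g14)); count-neutral Mathlib-side capital.  Nothing here is about HC —
HC_CM is proved only modulo the 7 printed citations until rung 0 closes.

## References
* D. Mumford, *Lectures on Curves on an Algebraic Surface*, Annals of Mathematics Studies 59 (1966), Lecture 8, 3° (ii) (p. 58);
  Lecture 14 (Theorem, p. 101). [Mumford1966CurvesSurface]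
* R. Hartshorne, *Algebraic Geometry*, GTM 52 (1977), III Thm. 9.9 (p. 261), III Thm. 12.11 and Cor. 12.9 (pp. 288–290),
  II Prop. 5.12. [Hartshorne1977]
* D. Mumford, *Abelian Varieties* (1970), §5 Cor. 2 (p. 50) and Cor. 3 (p. 53). [MumfordAV1970]
-/

noncomputable section

set_option backward.isDefEq.respectTransparency false

open CategoryTheory CategoryTheory.Limits CategoryTheory.Abelian Opposite TopologicalSpace AlgebraicGeometry TensorProduct

namespace Literature.AlgebraicGeometry.Modules

open Literature.AlgebraicGeometry.Morphisms Literature.AlgebraicGeometry.Motives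

/-! ## §2 The rank of `p_* G` is `h⁰` of every fibre with `H¹ = 0` -/

section PointwiseRank

/-- The rank of a base change `S ⊗_R M` does not depend on the `R`-algebra `S` up to `R`-algebra isomorphism. [folklore] -/
private theorem finrank_baseChange_eq_of_algEquiv' {R S₁ S₂ M : Type} [CommRing R] [CommRing S₁] [CommRing S₂]
    [Algebra R S₁] [Algebra R S₂] [AddCommGroup M] [Module R M] (e : S₁ ≃ₐ[R] S₂) :
    Module.finrank S₁ (S₁ ⊗[R] M) = Module.finrank S₂ (S₂ ⊗[R] M) := by
  let j : S₁ ⊗[R] M ≃ₗ[R] S₂ ⊗[R] M := TensorProduct.congr e.toLinearEquiv (LinearEquiv.refl R M)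
  have hc : ∀ (c : S₁) (x : S₁ ⊗[R] M), j (c • x) = e c • j x := by
    intro c x
    induction x using TensorProduct.induction_on with
    | zero => rw [smul_zero, map_zero, smul_zero]
    | tmul s m =>
      rw [TensorProduct.smul_tmul', TensorProduct.congr_tmul, TensorProduct.congr_tmul, TensorProduct.smul_tmul']
      change e (c * s) ⊗ₜ[R] m = (e c * e s) ⊗ₜ[R] m
      rw [map_mul]
    | add x y hx hy => rw [smul_add, map_add, hx, hy, map_add, smul_add]
  exact congrArg Cardinal.toNat (rank_eq_of_equiv_equiv e j.toAddEquiv e.bijective hc)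

/-- `Ext¹(𝒪, ·) = 0` transports along an isomorphism of the second argument. [folklore] -/
private theorem subsingleton_ext_one_of_iso {Y : Scheme.{0}} {M N : Y.Modules} (Φ : M ≅ N)
    (h : Subsingleton (Ext.{1} (unitModule Y) M 1)) : Subsingleton (Ext.{1} (unitModule Y) N 1) := by
  refine ⟨fun a b => ?_⟩
  have key : ∀ z : Ext.{1} (unitModule Y) N 1, z = (z.comp (Ext.mk₀ Φ.inv) (add_zero 1)).comp (Ext.mk₀ Φ.hom) (add_zero 1) :=
    fun z => by rw [Ext.comp_assoc_of_second_deg_zero, Ext.mk₀_comp_mk₀, Iso.inv_hom_id, Ext.comp_mk₀_id]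
  rw [key a, key b, Subsingleton.elim (a.comp _ _) (b.comp (Ext.mk₀ Φ.inv) (add_zero 1))]

/-- **THE RANK OF `p_* G` IS `h⁰` OF EVERY FIBRE WITH `H¹ = 0`** (Mumford §5 Cor. 2–3 / Hartshorne III 12.11, Cor. 12.9 read
backwards): `S` locally Noetherian, `p : X → S` proper flat, `G` finite locally free on `X` with `p_* G` locally free of rank
`r` (`HasRank`); then at every field point `x : Spec K → S` whose fibre `X₀ = X ×_S Spec K` has `Ext¹(𝒪_{X₀}, G|_{X₀}) = 0`,
`dim_{Γ(Spec K, 𝒪)} Γ(X₀, G|_{X₀}) = r`.  (Over an affine `V ∋ x`, `Γ(p_* G, V)` has stalk rank `r`; moved to the chart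
`p⁻¹V → Spec Γ(S, V)` (★ (S3) transport) it is `h⁰` of the residue-field fibre at the image point by the local step ★
`finrank_tensor_secMod_top_atPrime`; the given field point is a field extension of that one (Mathlib
`Scheme.SpecToEquivOfField`), along which `Ext¹`-vanishing and `h⁰` are invariant, ★ `Modules/CohomologyFlatBaseChange` §4.)
[cite: MumfordAV1970, §5 Cor. 2 (p. 50) and Cor. 3 (p. 53)] [cite: Hartshorne1977, III Thm. 12.11 (p. 290), Cor. 12.9 (p. 288)] -/
theorem finrank_secMod_fibre_eq_of_hasRank_pushforward {S X : Scheme.{0}} [IsLocallyNoetherian S] {p : X ⟶ S}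
    [IsProper p] [Flat p] (G : X.Modules) (hL : IsFiniteLocallyFree G) {r : ℕ}
    (hrk : HasRank ((Scheme.Modules.pushforward p).obj G) r)
    ⦃K : Type⦄ [Field K] ⦃X₀ : Scheme.{0}⦄ (k : X₀ ⟶ X) (f₀ : X₀ ⟶ Spec (CommRingCat.of K))
    (x : Spec (CommRingCat.of K) ⟶ S) (H : IsPullback k f₀ p x)
    (hvan : Subsingleton (Ext.{1} (unitModule X₀) ((Scheme.Modules.pullback k).obj G) 1)) :
    Module.finrank Γ(Spec (CommRingCat.of K), ⊤) (SecMod ((Scheme.Modules.pullback k).obj G) f₀.appTop.hom ⊤) = r := by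
  classical
  -- (1) an affine open `V ∋ t`, `t` the image of the field point
  obtain ⟨_, ⟨V, hV, rfl⟩, htV, -⟩ :=
    S.isBasis_affineOpens.exists_subset_of_mem_open (Set.mem_univ (x.base (IsLocalRing.closedPoint K))) isOpen_univ
  haveI : IsAffine (V : Scheme.{0}) := hV
  haveI : IsNoetherianRing Γ(S, V) := IsLocallyNoetherian.component_noetherian ⟨V, hV⟩
  -- the chart `fV : p⁻¹V → Spec Γ(S, V)`, proper and flat, and the bundle `GV = G|_{p⁻¹V}`
  have exf : ∃ fV : (p ⁻¹ᵁ V).toScheme ⟶ Spec (CommRingCat.of Γ(S, V)), fV = p.resLE V (p ⁻¹ᵁ V) le_rfl ≫ hV.isoSpec.hom :=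
    ⟨_, rfl⟩
  obtain ⟨fV, hfV⟩ := exf
  haveI : IsProper fV := by rw [hfV, Scheme.Hom.resLE_eq_morphismRestrict]; infer_instance
  haveI : Flat fV := by rw [hfV, Scheme.Hom.resLE_eq_morphismRestrict]; infer_instance
  let GV : (p ⁻¹ᵁ V).toScheme.Modules := (Scheme.Modules.pullback (p ⁻¹ᵁ V).ι).obj G
  have hLV : IsFiniteLocallyFree GV := hL.pullback _
  -- (2) `M₂ = Γ(p_* G, V)` is finite projective of stalk rank `r` over `Γ(S, V)` (`HasRank`, Stacks 0C3G)
  have hE : IsAffineLocalizing ((Scheme.Modules.pushforward p).obj G) := by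
    haveI := (HasRank.isFiniteLocallyFree' hrk).isVectorBundle.1
    exact IsAffineLocalizing.of_isQuasicoherent _
  have hfinE : IsAffineFiniteType ((Scheme.Modules.pushforward p).obj G) :=
    IsFiniteLocallyFree.isAffineFiniteType (HasRank.isFiniteLocallyFree' hrk)
  obtain ⟨hproj₂, hrk₂⟩ := (hasRank_iff_forall_projective_rankAtStalk hE hfinE r).mp hrk ⟨V, hV⟩
  haveI hfin₂ : Module.Finite Γ(S, V) Γ((Scheme.Modules.pushforward p).obj G, V) := hfinE hV
  haveI := hproj₂
  -- (3) the transport `(σ, μ)`: `σ : R = Γ(Spec Γ(S, V), 𝒪) ≅ Γ(S, V)`, `μ : M₁ = Γ(p⁻¹V, G|) ≅ Γ(p_* G, V) = M₂` (★ (S3)),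
  --     along which finiteness, projectivity and the stalk rank move (as in ★ `finite_projective_rankAtStalk_app_pushforward`)
  let R : Type := Γ(Spec (CommRingCat.of Γ(S, V)), ⊤)
  let M₁ : Type := SecMod GV fV.appTop.hom ⊤
  let M₂ : Type := Γ((Scheme.Modules.pushforward p).obj G, V)
  let σ : R ≃+* Γ(S, V) := (Scheme.ΓSpecIso Γ(S, V)).commRingCatIsoToRingEquiv
  have i₀ : (⊤ : (p ⁻¹ᵁ V).toScheme.Opens) ≤ (p ⁻¹ᵁ V).ι ⁻¹ᵁ (p ⁻¹ᵁ V) := (Scheme.Opens.ι_preimage_self _).ge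
  have hc : p ⁻¹ᵁ V = (p ⁻¹ᵁ V).ι ''ᵁ ⊤ := (Scheme.Opens.ι_image_top _).symm
  obtain ⟨μ, hμη, hημ, hμc⟩ := exists_sections_pullback_ι_transport G (p ⁻¹ᵁ V) ⊤ rfl i₀ hc
  let μe : M₁ ≃+ M₂ :=
    { toFun := fun t => show M₂ from μ (SecMod.val (L := GV) (ρ := fV.appTop.hom) t)
      invFun := fun m => SecMod.mk (ρ := fV.appTop.hom) (unitSectionLE (p ⁻¹ᵁ V).ι G i₀ (show Γ(G, p ⁻¹ᵁ V) from m))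
      left_inv := fun t => SecMod.val_injective (L := GV) (ρ := fV.appTop.hom) (hημ _)
      right_inv := fun m => hμη _
      map_add' := fun t t' => μ.map_add _ _ }
  have happ : ∀ a : R, X.presheaf.map (eqToHom hc).op (fV.appTop a) = p.app V (σ a) := by
    intro a
    rw [hfV, Scheme.Hom.comp_appTop, CategoryTheory.comp_apply, IsAffineOpen.isoSpec_hom_appTop,
      CategoryTheory.comp_apply]
    change X.presheaf.map (eqToHom hc).op
      ((p.resLE V (p ⁻¹ᵁ V) le_rfl).app ⊤ ((Scheme.Opens.topIso V).inv ((Scheme.ΓSpecIso Γ(S, V)).hom a))) = _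
    rw [resLE_self_app_top_apply, Iso.inv_hom_id_apply, map_eqToHom_topIso_inv]
    rfl
  have htoS : ∀ a : R, toSections fV.appTop.hom ⊤ a = fV.appTop a := by
    intro a
    have e1 : (homOfLE (le_top : (⊤ : (p ⁻¹ᵁ V).toScheme.Opens) ≤ ⊤)) = 𝟙 ⊤ := Subsingleton.elim _ _
    change (p ⁻¹ᵁ V).toScheme.presheaf.map (homOfLE le_top).op (fV.appTop a) = _
    rw [e1, op_id, CategoryTheory.Functor.map_id]
    rfl
  have hsemi : ∀ (a : R) (t : M₁), μe (a • t) = σ a • μe t := by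
    intro a t
    change μ (toSections fV.appTop.hom ⊤ a • SecMod.val (L := GV) (ρ := fV.appTop.hom) t) =
      p.app V (σ a) • μ (SecMod.val (L := GV) (ρ := fV.appTop.hom) t)
    rw [htoS, hμc, happ]
  -- (a) finiteness and (b) projectivity of `M₁`
  haveI hfin₁ : Module.Finite R M₁ := Module.Finite.of_addEquiv_semilinear (σ : R →+* Γ(S, V)) σ.surjective μe hsemi
  haveI := RingHomInvPair.of_ringEquiv σ
  haveI := RingHomInvPair.of_ringEquiv_symm σ
  let e₂ : M₁ ≃ₛₗ[(σ : R →+* Γ(S, V))] M₂ := { μe with map_smul' := hsemi }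
  haveI hproj₁ : Module.Projective R M₁ := Module.Projective.of_equiv e₂.symm
  -- (c) the stalk rank: `M₂` is the base change of `M₁` along the isomorphism `σ` (local instances kept inside this block)
  have hrk₁ : ∀ P : PrimeSpectrum R, Module.rankAtStalk (R := R) M₁ P = r := by
    letI algRA : Algebra R Γ(S, V) := (σ : R →+* Γ(S, V)).toAlgebra
    letI modR : Module R M₂ := Module.compHom M₂ (σ : R →+* Γ(S, V))
    haveI : IsScalarTower R Γ(S, V) M₂ :=
      ⟨fun a c m => by
        change (σ a * c) • m = σ a • (c • m)
        rw [mul_smul]⟩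
    let μl : M₁ →ₗ[R] M₂ := { μe.toAddMonoidHom with map_smul' := fun a t => hsemi a t }
    have hbc : IsBaseChange Γ(S, V) μl := by
      refine IsBaseChange.of_lift_unique μl fun Q _ _ _ _ g => ?_
      have hsymm : ∀ (c : Γ(S, V)) (m : M₂), μe.symm (c • m) = σ.symm c • μe.symm m := fun c m => by
        apply μe.injective
        rw [AddEquiv.apply_symm_apply, hsemi, AddEquiv.apply_symm_apply, RingEquiv.apply_symm_apply]
      let g' : M₂ →ₗ[Γ(S, V)] Q :=
        { toFun := fun m => g (μe.symm m)
          map_add' := fun m m' => by rw [map_add, map_add]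
          map_smul' := fun c m => by
            rw [hsymm, map_smul, RingHom.id_apply, ← algebraMap_smul Γ(S, V) (σ.symm c)]
            change σ (σ.symm c) • g (μe.symm m) = c • g (μe.symm m)
            rw [RingEquiv.apply_symm_apply] }
      refine ⟨g', ?_, ?_⟩
      · ext t
        change g (μe.symm (μe t)) = g t
        rw [AddEquiv.symm_apply_apply]
      · intro g'' hg''
        ext m
        have h := congrArg (fun φ : M₁ →ₗ[R] Q => φ (μe.symm m)) hg''
        simp only [LinearMap.coe_comp, LinearMap.coe_restrictScalars, Function.comp_apply] at h
        change g'' (μl (μe.symm m)) = g (μe.symm m) at h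
        change g'' m = g (μe.symm m)
        rw [← h]
        change g'' m = g'' (μe (μe.symm m))
        rw [AddEquiv.apply_symm_apply]
    haveI : Module.Flat R M₁ := Module.Flat.of_projective
    intro P
    have h := Module.rankAtStalk_isBaseChange hbc (P.comap (σ.symm : Γ(S, V) →+* R))
    rw [hrk₂] at h
    have hP : (P.comap (σ.symm : Γ(S, V) →+* R)).comap (algebraMap R Γ(S, V)) = P := by
      ext a
      change σ.symm (σ a) ∈ P.asIdeal ↔ a ∈ P.asIdeal
      rw [RingEquiv.symm_apply_apply]
    rw [hP] at h
    exact h.symm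
  haveI : Module.Flat R M₁ := Module.Flat.of_projective
  -- (4) the field point factors through `V`, then through the residue field of its image `y` in `Spec Γ(S, V)`
  have hrange : Set.range x.base ⊆ Set.range (Scheme.Opens.ι V).base := by
    rw [Scheme.Opens.range_ι]
    rintro _ ⟨pt, rfl⟩
    obtain rfl : pt = IsLocalRing.closedPoint K := Subsingleton.elim _ _
    exact htV
  let xV : Spec (CommRingCat.of K) ⟶ (V : Scheme.{0}) := IsOpenImmersion.lift (Scheme.Opens.ι V) x hrange
  have hxV : xV ≫ Scheme.Opens.ι V = x := IsOpenImmersion.lift_fac _ _ _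
  obtain ⟨⟨y', ψ⟩, hu⟩ : ∃ yψ : Σ y : Spec (CommRingCat.of Γ(S, V)),
      ((Spec (CommRingCat.of Γ(S, V))).residueField y ⟶ CommRingCat.of K),
      Spec.map yψ.2 ≫ (Spec (CommRingCat.of Γ(S, V))).fromSpecResidueField yψ.1 = xV ≫ hV.isoSpec.hom :=
    ⟨Scheme.SpecToEquivOfField K _ (xV ≫ hV.isoSpec.hom), (Scheme.SpecToEquivOfField K _).left_inv _⟩
  -- the image point is the contraction `y` of a prime `P` of `R = Γ(Spec Γ(S, V), 𝒪)`, at which `Γ(Spec A_y, 𝒪)` is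
  -- LITERALLY the localization of `R` of ★ `isLocalization_atPrime_Γ_Spec P` (used in step (9))
  let φ₀ : Γ(S, V) →+* R := (Scheme.ΓSpecIso (CommRingCat.of Γ(S, V))).symm.commRingCatIsoToRingEquiv.toRingHom
  obtain ⟨P, hP⟩ : ∃ P : PrimeSpectrum R, PrimeSpectrum.comap φ₀ P = y' := by
    refine ⟨PrimeSpectrum.comap (Scheme.ΓSpecIso (CommRingCat.of Γ(S, V))).hom.hom y',
      PrimeSpectrum.ext (Ideal.ext fun a => ?_)⟩
    simp only [PrimeSpectrum.comap_asIdeal, Ideal.mem_comap]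
    change (Scheme.ΓSpecIso (CommRingCat.of Γ(S, V))).hom ((Scheme.ΓSpecIso (CommRingCat.of Γ(S, V))).inv a) ∈ y'.asIdeal ↔ _
    rw [Iso.inv_hom_id_apply]
  subst hP
  let y : Spec (CommRingCat.of Γ(S, V)) := PrimeSpectrum.comap φ₀ P
  replace hu : Spec.map ψ ≫ (Spec (CommRingCat.of Γ(S, V))).fromSpecResidueField y = xV ≫ hV.isoSpec.hom := hu
  -- the field extension `φ : κ(y) → K` and the factorisation of `x` through the canonical point at `y`
  let φ : y.asIdeal.ResidueField →+* K := (ψ.hom).comp (Scheme.Spec.residueFieldIso (CommRingCat.of Γ(S, V)) y).inv.hom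
  have hφ : Spec.map (CommRingCat.ofHom φ) =
      Spec.map ψ ≫ Spec.map (Scheme.Spec.residueFieldIso (CommRingCat.of Γ(S, V)) y).inv := by
    change Spec.map (CommRingCat.ofHom ((ψ.hom).comp _)) = _
    rw [CommRingCat.ofHom_comp, CommRingCat.ofHom_hom, CommRingCat.ofHom_hom, Spec.map_comp]
  have hx : x = Spec.map (CommRingCat.ofHom φ) ≫
      (Spec.map (CommRingCat.ofHom (algebraMap Γ(S, V) y.asIdeal.ResidueField)) ≫ hV.isoSpec.inv ≫ Scheme.Opens.ι V) := by
    rw [hφ, Category.assoc, ← Category.assoc (Spec.map (Scheme.Spec.residueFieldIso _ y).inv),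
      Scheme.Spec.map_residueFieldIso_inv_eq_fromSpecResidueField, ← Category.assoc, hu, Category.assoc,
      Iso.hom_inv_id_assoc, hxV]
  -- (5) the canonical fibre at `y` and the square `X₀ = (fibre at y) ×_{κ(y)} Spec K`
  have hsq := isPullback_fiberι_comp_ι_SpecMap p V hV y
  rw [← hfV] at hsq
  have hw : k ≫ p = (f₀ ≫ Spec.map (CommRingCat.ofHom φ)) ≫
      (Spec.map (CommRingCat.ofHom (algebraMap Γ(S, V) y.asIdeal.ResidueField)) ≫ hV.isoSpec.inv ≫ Scheme.Opens.ι V) := by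
    rw [H.w, hx, Category.assoc]
  let ℓ : X₀ ⟶ fV.fiber y := hsq.lift k (f₀ ≫ Spec.map (CommRingCat.ofHom φ)) hw
  have hℓ₁ : ℓ ≫ (fV.fiberι y ≫ (p ⁻¹ᵁ V).ι) = k := hsq.lift_fst _ _ _
  have hℓ₂ : ℓ ≫ (fV.fiberToSpecResidueField y ≫ Spec.map (Scheme.Spec.residueFieldIso _ y).inv) =
      f₀ ≫ Spec.map (CommRingCat.ofHom φ) := hsq.lift_snd _ _ _
  have Hψ : IsPullback ℓ f₀ (fV.fiberToSpecResidueField y ≫ Spec.map (Scheme.Spec.residueFieldIso _ y).inv)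
      (Spec.map (CommRingCat.ofHom φ)) := by
    refine IsPullback.of_right ?_ hℓ₂ hsq
    rw [hℓ₁, ← hx]
    exact H
  -- (6) `Ext¹`-vanishing moves from `X₀` to the canonical fibre (field extension ★ `CohomologyFlatBaseChange` §4)
  --     `G_y := (fiberι y)^* (G|_{p⁻¹V})` and `k^* G ≅ ℓ^* G_y`
  have Ψ : (Scheme.Modules.pullback k).obj G ≅
      (Scheme.Modules.pullback ℓ).obj ((Scheme.Modules.pullback (fV.fiberι y)).obj GV) :=
    (Scheme.Modules.pullbackCongr hℓ₁).symm.app G ≪≫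
      ((Scheme.Modules.pullbackComp ℓ (fV.fiberι y ≫ (p ⁻¹ᵁ V).ι)).app G).symm ≪≫
        (Scheme.Modules.pullback ℓ).mapIso ((Scheme.Modules.pullbackComp (fV.fiberι y) (p ⁻¹ᵁ V).ι).app G).symm
  have hGy : IsAffineLocalizing ((Scheme.Modules.pullback (fV.fiberι y)).obj GV) := by
    haveI := (hLV.pullback (fV.fiberι y)).isVectorBundle.1
    exact IsAffineLocalizing.of_isQuasicoherent _
  haveI : IsProper (fV.fiberToSpecResidueField y ≫ Spec.map (Scheme.Spec.residueFieldIso _ y).inv) :=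
    IsProper.isStableUnderBaseChange.of_isPullback hsq inferInstance
  have hvan₀ : Subsingleton (Ext.{1} (unitModule X₀)
      ((Scheme.Modules.pullback ℓ).obj ((Scheme.Modules.pullback (fV.fiberι y)).obj GV)) 1) :=
    subsingleton_ext_one_of_iso Ψ hvan
  have hvany : Subsingleton (Ext.{1} (unitModule (fV.fiber y)) ((Scheme.Modules.pullback (fV.fiberι y)).obj GV) 1) :=
    (subsingleton_ext_unit_succ_iff_of_isPullback_specMap φ Hψ _ hGy 0).mp hvan₀
  -- (7) `h⁰` is invariant under the field extension
  have hfin : Module.finrank Γ(Spec (CommRingCat.of K), ⊤)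
      (SecMod ((Scheme.Modules.pullback k).obj G) f₀.appTop.hom ⊤) =
      Module.finrank Γ(Spec (CommRingCat.of y.asIdeal.ResidueField), ⊤)
        (SecMod ((Scheme.Modules.pullback (fV.fiberι y)).obj GV)
          (fV.fiberToSpecResidueField y ≫ Spec.map (Scheme.Spec.residueFieldIso _ y).inv).appTop.hom ⊤) := by
    obtain ⟨L, -⟩ := exists_secMod_linearEquiv_of_iso f₀.appTop.hom Ψ
    exact L.finrank_eq.trans (finrank_secMod_top_eq_of_isPullback_specMap φ Hψ _ hGy)
  -- (8) the local step at `y`: `h⁰` of the canonical fibre is the rank of `Γ(Spec A_y, 𝒪) ⊗ M₁`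
  have hloc := finrank_tensor_secMod_top_atPrime fV GV hLV y.asIdeal (isPullback_fiberι_SpecMap_algebraMap fV y) hvany
  -- (9) `Γ(Spec A_y, 𝒪)` is the localization of `R` at `P` (★ `isLocalization_atPrime_Γ_Spec`), so the rank of
  --     `Γ(Spec A_y, 𝒪) ⊗ M₁` is `rk_P M₁ = r` (Mathlib `Module.rankAtStalk_eq_finrank_tensorProduct`)
  letI algRl : Algebra R Γ(Spec (CommRingCat.of (Localization.AtPrime y.asIdeal)), ⊤) :=
    ((Spec.map (CommRingCat.ofHom (algebraMap Γ(S, V) (Localization.AtPrime y.asIdeal)))).appLE ⊤ ⊤ le_top).hom.toAlgebra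
  haveI : IsLocalization.AtPrime Γ(Spec (CommRingCat.of (Localization.AtPrime y.asIdeal)), ⊤) P.asIdeal :=
    isLocalization_atPrime_Γ_Spec P.asIdeal
  let eL : Localization.AtPrime P.asIdeal ≃ₐ[R] Γ(Spec (CommRingCat.of (Localization.AtPrime y.asIdeal)), ⊤) :=
    IsLocalization.algEquiv P.asIdeal.primeCompl _ _
  have h9 := hrk₁ P
  rw [Module.rankAtStalk_eq_finrank_tensorProduct, finrank_baseChange_eq_of_algEquiv' eL] at h9
  exact hfin.trans (hloc.symm.trans h9)

end PointwiseRank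

end Literature.AlgebraicGeometry.Modules

/-! ## §3–§4 The twists of a flat closed family `Z ⊆ 𝐏(ι; T)` at a PRESENTED field point with infinite residue field -/

namespace Literature.AlgebraicGeometry.Motives

open Polynomial
open Literature.Algebra.Homology Literature.Algebra.Homology.LaurentCech Literature.Algebra.Homology.OrderedCech
open Literature.AlgebraicGeometry.Morphisms Literature.AlgebraicGeometry.Morphisms.ProjCech
open Literature.AlgebraicGeometry.Modules Literature.AlgebraicGeometry.Modules.SerreTwist

-- `Proj.map : 𝐏ⁿ_K ⟶ 𝐏ⁿ_ℤ` (the letter `w` of a presented fibre) needs the graded-algebra instance on polynomial rings (the ★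
-- `CechH1Projective` ∕ `SerreTwistModProjMap` idiom).
attribute [local instance] MvPolynomial.gradedAlgebra

section FibreTwists

variable {ι : Type} (hn : 1 ≤ Nat.card ι) {T Z : Scheme.{0}} [IsLocallyNoetherian T]
  (i : Z ⟶ Morphisms.projectiveSpace ι T) [IsClosedImmersion i] [Flat (i ≫ Morphisms.projectiveSpaceFst ι T)]
  (P : ℚ[X]) (e₀ : ℕ) (R : ℕ → ℕ) (hR : ∀ e, e₀ ≤ e → (R e : ℚ) = P.eval (e : ℚ))
  (hrk : ∀ e, e₀ ≤ e → HasRank ((Scheme.Modules.pushforward (i ≫ Morphisms.projectiveSpaceFst ι T)).obj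
    (SerreTwist.twistMod (i ≫ pullback.snd (terminal.from T) (terminal.from (Morphisms.projectiveSpaceInt ι)))
      (unitModule Z) e)) (R e))
  (d k : ℕ) (hk : (k : ℚ) = P.eval (d : ℚ))
  (hd : regularityBound (preHilbertPoly ℚ (Nat.card ι) 0) 0 (preHilbertPoly ℚ (Nat.card ι) 0 - P) - 1 ≤ (d : ℤ))
  ⦃K : Type⦄ [Field K] [Infinite K] [Algebra intU.{0} K] ⦃X₀ : Scheme.{0}⦄ (kX : X₀ ⟶ Z) (f₀ : X₀ ⟶ Spec (.of K))
  (x : Spec (.of K) ⟶ T) (H : IsPullback kX f₀ (i ≫ Morphisms.projectiveSpaceFst ι T) x)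
  (ιK : X₀ ⟶ PP K (Nat.card ι)) [IsClosedImmersion ιK]
  (hf₀ : ιK ≫ ProjBaseChangeRing.projToSpec (Fin (Nat.card ι + 1)) K = f₀)
  (w : kX ≫ (i ≫ pullback.snd (terminal.from T) (terminal.from (Morphisms.projectiveSpaceInt ι))) =
    ιK ≫ Proj.map (ProjBaseChangeRing.mapGraded intU.{0} K (Fin (Nat.card ι + 1)))
      (ProjBaseChangeRing.irrelevant_le_map intU.{0} K (Fin (Nat.card ι + 1))))

include hn hR hrk H hf₀ w in
/-- **§3 The Hilbert polynomial of a presented fibre is `P`** (Mumford, Lect. 8, 3° (ii) read on ONE fibre; Hartshorne III 9.9):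
`Z ⊆ 𝐏(ι; T)` a closed family, flat over the locally Noetherian `T`, with `(p_Z)_* 𝒪_Z(e)` locally free of rank `P(e)` for
`e ≥ e₀`; `X₀ = Z ×_T Spec K` a fibre at a field point with `K` infinite, presented as `ιK : X₀ ⊆ 𝐏ⁿ_K` (`hf₀`, `w`), and `QZ` the
Hilbert polynomial of `X₀ ⊆ 𝐏ⁿ_K` (alternating Čech dimensions, ★ `LaurentCech.exists_hilbertPolynomial`).  Then `QZ = P`: for
`e ≥ max (e₀, B(QZ) - 1)`, `Ext¹(𝒪_{X₀}, 𝒪_{X₀}(e)) = 0` and `h⁰(X₀, 𝒪_{X₀}(e)) = QZ(e)` (★ L-a (a), (b)), so by §2 (with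
`k^* 𝒪_Z(e) ≅ 𝒪_{X₀}(e)`, ★ `SerreTwist.exists_pullback_twistMod_iso_of_sq`) `QZ(e) = rk (p_Z)_* 𝒪_Z(e) = P(e)`; two rational
polynomials agreeing at all large integers coincide. [cite: Mumford1966CurvesSurface, Lecture 8, 3° (ii)]
[cite: Hartshorne1977, III Thm. 9.9 (p. 261) and III Cor. 12.9 (p. 288)] -/
theorem hilbertPolynomial_fibre_eq_of_hasRank_twists (QZ : ℚ[X])
    (hQZ : ∀ m : ℤ, ((∑ q ∈ Finset.range (Nat.card ι + 1), (-1 : ℤ) ^ q *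
      (Module.finrank K ((quot (fun _ : Unit => (0 : ℤ)) (KZ ιK) m).homology q) : ℤ) : ℤ) : ℚ) = QZ.eval (m : ℚ)) :
    QZ = P := by
  subst hf₀
  haveI : IsProper (i ≫ Morphisms.projectiveSpaceFst ι T) := inferInstance
  set B : ℤ := regularityBound (preHilbertPoly ℚ (Nat.card ι) 0) 0 (preHilbertPoly ℚ (Nat.card ι) 0 - QZ) with hB
  -- `QZ(e) = P(e)` for every natural `e ≥ max (e₀, B - 1)`
  have key : ∀ e : ℕ, e₀ ≤ e → B - 1 ≤ (e : ℤ) → QZ.eval (e : ℚ) = P.eval (e : ℚ) := by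
    intro e he₀ he
    obtain ⟨φ, -, -⟩ := exists_pullback_twistMod_iso_of_sq intU.{0} K kX
      (i ≫ pullback.snd (terminal.from T) (terminal.from (Morphisms.projectiveSpaceInt ι))) ιK w e
    -- (a) `Ext¹ = 0` on the fibre, moved to `k^* 𝒪_Z(e)`
    have hvan : Subsingleton (Ext.{1} (unitModule X₀) ((Scheme.Modules.pullback kX).obj
        (twistMod (i ≫ pullback.snd (terminal.from T) (terminal.from (Morphisms.projectiveSpaceInt ι)))
          (unitModule Z) e)) 1) :=
      subsingleton_ext_one_of_iso φ.symm (subsingleton_ext_one_twistMod_of_hilbertPolynomial hn ιK QZ hQZ he)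
    -- §2: `h⁰(X₀, k^* 𝒪_Z(e)) = R e = P(e)`
    have h2 := finrank_secMod_fibre_eq_of_hasRank_pushforward
      (twistMod (i ≫ pullback.snd (terminal.from T) (terminal.from (Morphisms.projectiveSpaceInt ι))) (unitModule Z) e)
      (isFiniteLocallyFree_twistMod_unitModule _ e) (hrk e he₀) kX _ x H hvan
    -- (b) `h⁰(X₀, 𝒪_{X₀}(e)) = QZ(e)`, moved to `k^* 𝒪_Z(e)`
    obtain ⟨L, -⟩ := exists_secMod_linearEquiv_of_iso
      (ιK ≫ ProjBaseChangeRing.projToSpec (Fin (Nat.card ι + 1)) K).appTop.hom φ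
    have hb : ((Module.finrank Γ(Spec (CommRingCat.of K), ⊤) (SecMod ((Scheme.Modules.pullback kX).obj
        (twistMod (i ≫ pullback.snd (terminal.from T) (terminal.from (Morphisms.projectiveSpaceInt ι))) (unitModule Z) e))
        (ιK ≫ ProjBaseChangeRing.projToSpec (Fin (Nat.card ι + 1)) K).appTop.hom ⊤) : ℕ) : ℚ) = QZ.eval (e : ℚ) := by
      rw [L.finrank_eq]
      exact finrank_secMod_twistMod_eq_eval_of_hilbertPolynomial hn ιK QZ hQZ he
    rw [← hb, h2, hR e he₀]
  -- two rational polynomials agreeing on the infinite set `{e : ℕ | e ≥ max}` are equal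
  apply Polynomial.eq_of_infinite_eval_eq QZ P
  refine Set.Infinite.mono (s := (fun e : ℕ => (e : ℚ)) '' {e : ℕ | e₀ ≤ e ∧ B - 1 ≤ (e : ℤ)}) ?_ ?_
  · rintro _ ⟨e, ⟨he₀, he⟩, rfl⟩
    exact key e he₀ he
  · refine Set.Infinite.image (fun a _ b _ h => by exact_mod_cast h) ?_
    refine Set.infinite_of_forall_exists_gt fun n => ⟨max (max (n + 1) e₀) B.toNat, ⟨?_, ?_⟩, ?_⟩
    · exact le_trans (le_max_right _ _) (le_max_left _ _)
    · have := Int.self_le_toNat B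
      have h2 : ((max (max (n + 1) e₀) B.toNat : ℕ) : ℤ) ≥ (B.toNat : ℤ) := by exact_mod_cast le_max_right _ _
      omega
    · exact lt_of_lt_of_le (Nat.lt_succ_self n) (le_trans (le_max_left _ _) (le_max_left _ _))

include hn hR hrk hd H hf₀ w in
/-- **(E1) `Ext¹_{𝒪_{X₀}}(𝒪_{X₀}, k^* 𝒪_Z(d)) = 0` for `d ≥ B(P) - 1`** at a presented field point with infinite residue field of a
flat closed family `Z ⊆ 𝐏(ι; T)` whose twists have locally free direct images of ranks `P(e)` (`e ≥ e₀`) — the `hvan` letter of ★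
`Motives/FlatFamilyGrassmannianPoint.existsUnique_hom_grassmannian_of_forall_fieldPoint`: the fibre's Hilbert polynomial is `P`
(§3), Mumford's uniform regularity gives the vanishing for `𝒪_{X₀}(d)` (★ L-a `subsingleton_ext_one_twistMod_of_hilbertPolynomial`),
and `k^* 𝒪_Z(d) ≅ 𝒪_{X₀}(d)` (★ `SerreTwist.exists_pullback_twistMod_iso_of_sq`).
[cite: Mumford1966CurvesSurface, Lecture 14 (Theorem, p. 101) and Lecture 8, 3° (ii)] [cite: Hartshorne1977, III Thm. 9.9 (p. 261)] -/
theorem subsingleton_ext_one_pullback_twistMod_of_hasRank_twists :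
    Subsingleton (Ext.{1} (unitModule X₀) ((Scheme.Modules.pullback kX).obj
      (SerreTwist.twistMod (i ≫ pullback.snd (terminal.from T) (terminal.from (Morphisms.projectiveSpaceInt ι)))
        (unitModule Z) d)) 1) := by
  obtain ⟨QZ, hQZ, -⟩ :=
    exists_hilbertPolynomial (k := K) (e := fun _ : Unit => (0 : ℤ)) hn (K := KZ ιK) (isGraded_KZ ιK)
  have hQP := hilbertPolynomial_fibre_eq_of_hasRank_twists hn i P e₀ R hR hrk kX f₀ x H ιK hf₀ w QZ hQZ
  rw [hQP] at hQZ
  obtain ⟨φ, -, -⟩ := exists_pullback_twistMod_iso_of_sq intU.{0} K kX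
    (i ≫ pullback.snd (terminal.from T) (terminal.from (Morphisms.projectiveSpaceInt ι))) ιK w d
  exact subsingleton_ext_one_of_iso φ.symm (subsingleton_ext_one_twistMod_of_hilbertPolynomial hn ιK P hQZ hd)

include hn hR hrk hk hd H hf₀ w in
/-- **(E2) `dim_{Γ(Spec K, 𝒪)} Γ(X₀, k^* 𝒪_Z(d)) = k = P(d)` for `d ≥ B(P) - 1`** at a presented field point with infinite residue
field — the `hrank` letter of ★ `existsUnique_hom_grassmannian_of_forall_fieldPoint`: §3 (`QZ = P`), ★ L-a
`finrank_secMod_twistMod_eq_eval_of_hilbertPolynomial` on `𝒪_{X₀}(d)` and the sections transport along `k^* 𝒪_Z(d) ≅ 𝒪_{X₀}(d)`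
(★ `exists_secMod_linearEquiv_of_iso`). [cite: Mumford1966CurvesSurface, Lecture 14 (Theorem, p. 101) and Lecture 8, 3° (ii)]
[cite: Hartshorne1977, III Thm. 9.9 (p. 261)] -/
theorem finrank_secMod_pullback_twistMod_of_hasRank_twists :
    Module.finrank Γ(Spec (CommRingCat.of K), ⊤) (SecMod ((Scheme.Modules.pullback kX).obj
      (SerreTwist.twistMod (i ≫ pullback.snd (terminal.from T) (terminal.from (Morphisms.projectiveSpaceInt ι)))
        (unitModule Z) d)) f₀.appTop.hom ⊤) = k := by
  obtain ⟨QZ, hQZ, -⟩ :=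
    exists_hilbertPolynomial (k := K) (e := fun _ : Unit => (0 : ℤ)) hn (K := KZ ιK) (isGraded_KZ ιK)
  have hQP := hilbertPolynomial_fibre_eq_of_hasRank_twists hn i P e₀ R hR hrk kX f₀ x H ιK hf₀ w QZ hQZ
  rw [hQP] at hQZ
  subst hf₀
  obtain ⟨φ, -, -⟩ := exists_pullback_twistMod_iso_of_sq intU.{0} K kX
    (i ≫ pullback.snd (terminal.from T) (terminal.from (Morphisms.projectiveSpaceInt ι))) ιK w d
  obtain ⟨L, -⟩ := exists_secMod_linearEquiv_of_iso
    (ιK ≫ ProjBaseChangeRing.projToSpec (Fin (Nat.card ι + 1)) K).appTop.hom φ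
  have hb : ((Module.finrank Γ(Spec (CommRingCat.of K), ⊤) (SecMod ((Scheme.Modules.pullback kX).obj
      (twistMod (i ≫ pullback.snd (terminal.from T) (terminal.from (Morphisms.projectiveSpaceInt ι))) (unitModule Z) d))
      (ιK ≫ ProjBaseChangeRing.projToSpec (Fin (Nat.card ι + 1)) K).appTop.hom ⊤) : ℕ) : ℚ) = P.eval (d : ℚ) := by
    rw [L.finrank_eq]
    exact finrank_secMod_twistMod_eq_eval_of_hilbertPolynomial hn ιK P hQZ hd
  rw [← hk] at hb
  exact_mod_cast hb

include hn hR hrk hd H hf₀ w in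
/-- **(E3) the restricted MONOMIAL SECTIONS `η_k(μ_w|_Z)`, `w : Fin d → Fin (n + 1)`, SPAN `Γ(X₀, k^* 𝒪_Z(d))` over
`Γ(Spec K, 𝒪)` for `d ≥ B(P) - 1`** at a presented field point with infinite residue field — the `hspan` letter of ★
`existsUnique_hom_grassmannian_of_forall_fieldPoint`: §3 (`QZ = P`), ★ L-a (c) `span_monomialSections_eq_top_of_hilbertPolynomial`
(the `μ_w|_{X₀}` span `Γ(X₀, 𝒪_{X₀}(d))`), and the isomorphism `k^* 𝒪_Z(d) ≅ 𝒪_{X₀}(d)` of ★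
`SerreTwist.exists_pullback_twistMod_iso_of_sq` maps `η_k(μ_w|_Z) ↦ μ_w|_{X₀}`.
[cite: Mumford1966CurvesSurface, Lecture 14 (Theorem, p. 101) and Lecture 8, 3° (ii)] [cite: Hartshorne1977, II Prop. 5.12 (c)] -/
theorem secMod_mk_mem_span_monomialSection_of_hasRank_twists :
    ∀ σ : Γ((Scheme.Modules.pullback kX).obj
      (SerreTwist.twistMod (i ≫ pullback.snd (terminal.from T) (terminal.from (Morphisms.projectiveSpaceInt ι)))
        (unitModule Z) d), ⊤),
      SecMod.mk (L := (Scheme.Modules.pullback kX).obj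
          (SerreTwist.twistMod (i ≫ pullback.snd (terminal.from T) (terminal.from (Morphisms.projectiveSpaceInt ι)))
            (unitModule Z) d)) (ρ := f₀.appTop.hom) (U := ⊤) σ ∈
        Submodule.span Γ(Spec (CommRingCat.of K), ⊤) (Set.range fun wd : Fin d → Fin (Nat.card ι + 1) ↦
          SecMod.mk (L := (Scheme.Modules.pullback kX).obj
            (SerreTwist.twistMod (i ≫ pullback.snd (terminal.from T) (terminal.from (Morphisms.projectiveSpaceInt ι)))
              (unitModule Z) d)) (ρ := f₀.appTop.hom) (U := ⊤)
            (unitSectionLE kX _ (V := ⊤) (U := ⊤) le_top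
              (SerreTwist.monomialSection
                (i ≫ pullback.snd (terminal.from T) (terminal.from (Morphisms.projectiveSpaceInt ι))) d wd))) := by
  intro σ
  obtain ⟨QZ, hQZ, -⟩ :=
    exists_hilbertPolynomial (k := K) (e := fun _ : Unit => (0 : ℤ)) hn (K := KZ ιK) (isGraded_KZ ιK)
  have hQP := hilbertPolynomial_fibre_eq_of_hasRank_twists hn i P e₀ R hR hrk kX f₀ x H ιK hf₀ w QZ hQZ
  rw [hQP] at hQZ
  subst hf₀
  obtain ⟨φ, -, hφμ⟩ := exists_pullback_twistMod_iso_of_sq intU.{0} K kX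
    (i ≫ pullback.snd (terminal.from T) (terminal.from (Morphisms.projectiveSpaceInt ι))) ιK w d
  obtain ⟨L, hL⟩ := exists_secMod_linearEquiv_of_iso
    (ιK ≫ ProjBaseChangeRing.projToSpec (Fin (Nat.card ι + 1)) K).appTop.hom φ
  -- `L` maps `η_k(μ_w|_Z)` to `μ_w|_{X₀}`
  have hLμ : ∀ wd : Fin d → Fin (Nat.card ι + 1),
      L (SecMod.mk (L := (Scheme.Modules.pullback kX).obj
          (SerreTwist.twistMod (i ≫ pullback.snd (terminal.from T) (terminal.from (Morphisms.projectiveSpaceInt ι)))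
            (unitModule Z) d)) (ρ := (ιK ≫ ProjBaseChangeRing.projToSpec (Fin (Nat.card ι + 1)) K).appTop.hom) (U := ⊤)
          (unitSectionLE kX _ (V := ⊤) (U := ⊤) le_top
            (SerreTwist.monomialSection
              (i ≫ pullback.snd (terminal.from T) (terminal.from (Morphisms.projectiveSpaceInt ι))) d wd))) =
        SecMod.mk (L := SerreTwist.twistMod ιK (unitModule X₀) d)
          (ρ := (ιK ≫ ProjBaseChangeRing.projToSpec (Fin (Nat.card ι + 1)) K).appTop.hom) (U := ⊤)
          (monomialSection ιK d wd) := by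
    intro wd
    apply SecMod.val_injective (L := SerreTwist.twistMod ιK (unitModule X₀) d)
      (ρ := (ιK ≫ ProjBaseChangeRing.projToSpec (Fin (Nat.card ι + 1)) K).appTop.hom)
    rw [hL]
    exact hφμ wd
  -- the spanning set of ★ L-a (c) is the image under `L` of ours
  have hc := span_monomialSections_eq_top_of_hilbertPolynomial hn ιK P hQZ hd
  have himg : (Set.range fun wd : Fin d → Fin (Nat.card ι + 1) =>
      SecMod.mk (L := SerreTwist.twistMod ιK (unitModule X₀) d)
        (ρ := (ιK ≫ ProjCech.toSpec K (Nat.card ι)).appTop.hom) (U := ⊤) (monomialSection ιK d wd)) =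
      L '' Set.range fun wd : Fin d → Fin (Nat.card ι + 1) =>
        SecMod.mk (L := (Scheme.Modules.pullback kX).obj
          (SerreTwist.twistMod (i ≫ pullback.snd (terminal.from T) (terminal.from (Morphisms.projectiveSpaceInt ι)))
            (unitModule Z) d)) (ρ := (ιK ≫ ProjBaseChangeRing.projToSpec (Fin (Nat.card ι + 1)) K).appTop.hom) (U := ⊤)
          (unitSectionLE kX _ (V := ⊤) (U := ⊤) le_top
            (SerreTwist.monomialSection
              (i ≫ pullback.snd (terminal.from T) (terminal.from (Morphisms.projectiveSpaceInt ι))) d wd)) := by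
    rw [← Set.range_comp]
    exact congrArg Set.range (funext fun wd => (hLμ wd).symm)
  have hmem : L (SecMod.mk (L := (Scheme.Modules.pullback kX).obj
      (SerreTwist.twistMod (i ≫ pullback.snd (terminal.from T) (terminal.from (Morphisms.projectiveSpaceInt ι)))
        (unitModule Z) d)) (ρ := (ιK ≫ ProjBaseChangeRing.projToSpec (Fin (Nat.card ι + 1)) K).appTop.hom) (U := ⊤) σ) ∈
      Submodule.span Γ(Spec (CommRingCat.of K), ⊤) (Set.range fun wd : Fin d → Fin (Nat.card ι + 1) =>
        SecMod.mk (L := SerreTwist.twistMod ιK (unitModule X₀) d)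
          (ρ := (ιK ≫ ProjCech.toSpec K (Nat.card ι)).appTop.hom) (U := ⊤) (monomialSection ιK d wd)) := by
    rw [hc]
    exact Submodule.mem_top
  rw [himg, Submodule.span_image_linearEquiv] at hmem
  obtain ⟨y, hy, hyσ⟩ := Submodule.mem_map.mp hmem
  rw [← L.injective hyσ]
  exact hy

end FibreTwists

end Literature.AlgebraicGeometry.Motives

end
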